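import Mathlib.LinearAlgebra.Alternating.DomCoprod
import Mathlib.Algebra.Algebra.Bilinear
import Mathlib.Analysis.Calculus.ContDiff.Defs
import Mathlib.Analysis.Calculus.FDeriv.Basic
import Mathlib.MeasureTheory.Integral.Bochner.Set
import Mathlib.Analysis.Complex.Basic
import Mathlib.Topology.Algebra.Module.Determinant
import Literature.NumberTheory.Transcendental.KZProduct
import Literature.AlgebraicGeometry.Motives.AffineAlgebraicDeRham
import HarnessLib

/-!
# The pure naive period map: interface (definition request `defn-PureNaivePeriodMap`)

Route `KontsevichZagierPeriods/MotivatedMoves` (informal cruxes *MotivatedTransfer*,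
*AbelianHodgeDividend*) posits a **transfer datum** `Φ` from the classical presentation of pure
periods — a smooth projective variety `X` over `ℚ̄` with a projective embedding, an algebraic
`i`-form `ω` regular on an affine open `U ⊂ X`, a closed `ℚ̄`-semialgebraic oriented `i`-cycle
`γ ⊂ U(ℂ)` — to PAIRS of formal `ℤ`-combinations of Kontsevich–Zagier integral representations
(real and imaginary parts), `Φ(X, ω, γ) ∈ KZ.FormalRep × KZ.FormalRep`
(`Literature.NumberTheory.Transcendental.KZ.FormalRep`, file `KZCalculus.lean`), subject to axioms
that hold only MODULO the subgroup `KZ.relations` generated by the four moves of the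
Kontsevich–Zagier calculus [Kontsevich–Zagier 2001, §1.2]: additivity, value-correctness
(`KZ.eval Φ_re = Re ∫_γ ω`, `KZ.eval Φ_im = Im ∫_γ ω`), independence of the parametrisation,
vanishing on exact forms and on boundaries, and multiplicativity for the product of
`KZProduct.lean`. The request asks for the INTERFACE only; the CONSTRUCTION of such a datum
("naive periods are cohomological periods", Huber–Müller-Stach 2017, Ch. 12, proof of
Thm. 12.2.1: semialgebraic triangulation, parametrise the simplices, pull `ω` back to a top-degree
semialgebraic integrand) is a separate statement of the route (`Nonempty (PureNaivePeriodMap K σ)`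
for `K = ℚ̄`), deliberately NOT asserted here: nothing in this file claims that an instance exists.

## The concrete model (what `X`, `ω`, `γ`, `∫_γ ω` are in Lean)

We follow the printed proof of [Huber–Müller-Stach 2017, Thm. 12.2.1] (= Part III draft 2015,
Lemma 11.2.2), which passes at once to an affine open `U₀ ⊂ X ∩ {x₀ ≠ 0}` containing the cycle and
writes `ω` in affine coordinates, `ω = Σ_J f_J dx_J`:

* **Varieties.** An affine `K`-variety with a closed embedding in affine space is an ideal
  `I ⊆ K[x₁, …, x_N]` (`U = V(I) ⊆ 𝔸ᴺ_K`); every affine open of a projective `X ⊂ ℙᴹ` is of this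
  form (chart coordinates, plus `1/g` as an extra coordinate). Its complex points along
  `σ : K →+* ℂ` are `NaivePeriods.complexZeroLocus σ I = {z ∈ ℂᴺ | ∀ f ∈ I, f^σ(z) = 0}`.
  Smoothness / projectivity of `X` are not needed to STATE the axioms and are therefore not
  fields; they enter the route's later items as hypotheses on `I`.
* **Forms.** Algebraic `i`-forms on `U` are represented by polynomial `i`-forms on `𝔸ᴺ`,
  `AffineDeRham.PolyForm K N i` (`Literature/AlgebraicGeometry/Motives/AffineAlgebraicDeRham.lean`:
  `Ω^i(U) = PolyForm ⧸ vanishingForms I i`, exterior derivative `AffineDeRham.extDeriv`, the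
  predicates `IsClosedOn I ω`, forms `vanishingForms I i` restricting to `0` on `U`). The complex
  `i`-form `ω^σ` on `ℂᴺ` attached to `ω` is `NaivePeriods.evalC σ ω` (multilinear extension of the
  coefficient system to complex vectors).
* **Cycles.** `γ` is a CUBICAL chain: a formal `ℤ`-combination (`NaivePeriods.CubicalChain N i`,
  a free abelian group) of singular cubes `φ : [0,1]ⁱ → ℂᴺ` that are *admissible*
  (`NaivePeriods.SingularCube.IsAdmissible`): `ℚ`-semialgebraic as maps into `ℝ²ᴺ` (real and
  imaginary parts of the affine coordinates; `ℚ̄ ∩ ℝ`-semialgebraic = `ℚ`-semialgebraic),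
  continuous on the closed cube, `C^∞` on the open cube, and recursively so on every face — the
  regularity of the open simplices of a semialgebraic triangulation [Huber–Müller-Stach, Part I
  draft 2015, Prop. 2.6.8–2.6.9; Bochnak–Coste–Roy 1998, Thm. 9.2.1]. Cubes rather than simplices:
  the product of two cubes is a cube, matching the block convention of `KZ.IntegralRep.prod`
  (first coordinates / last coordinates); a simplex is the image of a cube under the
  semialgebraic collapse `(t₁, t₁t₂, …)`, so nothing is lost. Boundary
  `NaivePeriods.CubicalChain.boundary` with Spivak's signs, "closed" = boundary zero,
  "`γ ⊂ U(ℂ)`" = `IsAdmissibleIn (U(ℂ)) γ`.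
* **Integration.** `∫_φ ω = ∫_{(0,1)ⁱ} ω^σ(φ(t))(∂₁φ(t), …, ∂ᵢφ(t)) dt` (Bochner integral for
  Lebesgue measure; `NaivePeriods.SingularCube.integral`), extended additively to chains
  (`NaivePeriods.CubicalChain.integral`). These are the naive periods of
  [Huber–Müller-Stach 2017, Def. 12.1.1] written through a parametrisation.

## The interface

`Literature.NumberTheory.Transcendental.PureNaivePeriodMap K σ` bundles
`Φ : PolyForm K N i → SingularCube N i → FormalRep × FormalRep` (all `N`, `i`) with the axioms,
each an identity in `FormalRep × FormalRep` modulo `KZ.relations₂ = relations × relations`: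
`add_form`, `smul_form` (linearity in `ω`; algebraic scalars act through `0`-dimensional constant
representations, the idiom of the route's item *ConstantMatrixUnit*), `eval_fst`/`eval_snd`
(value-correctness), `vanish` (forms vanishing on `U` integrate to relations along cubes in
`U(ℂ)`, so `Φ` descends to `Ω^i(U)`), `exact` (`Φ(dη, γ) ≡ 0` for closed `γ`), `boundary`
(`Φ(ω, ∂β) ≡ 0` for `ω` closed on `U` and `β ⊂ U(ℂ)`), `reparam` (orientation-preserving
semialgebraic reparametrisation of a cube — one change-of-variables move), `mul`
(`Φ(ω ⊠ ω', φ × ψ) ≡ Φ(ω, φ) · Φ(ω', ψ)` for the complex product `KZ.cmul` of pairs built from the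
ring structure of `KZProduct.lean`). Additivity in `γ` is built in: `Φ` is given on cubes and
`PureNaivePeriodMap.onChain` is its additive extension. Independence of the triangulation of a
cycle, for closed forms, is the proved consequence `onChain_sub_onChain_mem_of_boundary`
(homologous admissible cycles have equivalent images).

## Proved here (sanity of the conventions)

* `NaivePeriods.insertNth_insertNth_comm` — two insertions into a tuple commute up to the index
  swap `(j, k) ↦ (j.succAbove k, k.predAbove j)` (the cubical identities), and
  `NaivePeriods.CubicalChain.boundary_boundary` — **`∂ ∘ ∂ = 0`** for the boundary with Spivak's
  signs (terms cancel in pairs under the fixed-point-free involution `faceSwap`, which flips the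
  sign `(-1)^{j+k}`);
* `CubicalChain.IsAdmissibleIn.boundary` — the boundary of an admissible chain in `S` is an
  admissible chain in `S`;
* `evalC_add`, `evalC_smul` (`σ`-semilinearity of `ω ↦ ω^σ`), `evalC_ofPoly`,
  `SingularCube.integral_eq_integrand_of_dim_zero` (in dimension `0` the integral over the
  one-point cube of volume `1` is the point value), `isSemialgebraic_closedUnitCube/openUnitCube`;
* for any `P : PureNaivePeriodMap K σ`: value-correctness, additivity and vanishing along CHAINS
  (`eval_onChain`, `onChain_add_sub_mem`, `onChain_mem_of_mem_vanishingForms`), descent of `Φ` to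
  `Ωⁱ(U)` (`onChain_sub_onChain_mem_of_sub_mem_vanishingForms`), `Φ_zero_mem`.

## References

* M. Kontsevich, D. Zagier, *Periods* (2001), §1.1 (definition, "algebraic" may replace
  "rational"), §1.2 (the three rules), §4.1 p. 31 (products by Fubini) [KontsevichZagier2001].
* A. Huber, S. Müller-Stach, *Periods and Nori Motives* (2017), §2.6 (semialgebraic sets and
  triangulations), Def. 12.1.1 (naive periods), Thm. 12.2.1 and its proof
  [HuberMullerStachPeriods2017]; Part III draft (2015), Def. 11.1.1, Prop. 11.1.2, Lemma 11.2.2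
  (read: held text pp. 20–27) [HuberMullerStachPeriodsIII2015]; Part I draft (2015), Def. 2.6.1,
  Def. 2.6.2, Rem. 2.6.6, Def. 2.6.7, Prop. 2.6.8, Prop. 2.6.9 (read: pp. 59–66)
  [HuberMullerStachPeriodsI2015].
* J. Bochnak, M. Coste, M.-F. Roy, *Real Algebraic Geometry* (1998), Def. 2.2.5, Thm. 9.2.1
  [BochnakCosteRoy1998].
* M. Spivak, *Calculus on Manifolds* (1965), Ch. 4 (singular cubes, `∂c = Σ (−1)^{i+α} c_{(i,α)}`,
  Stokes on chains).

## Design notes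

* `Φ` is TOTAL on cubes (junk outside the admissible ones); every axiom is guarded by
  admissibility. `K` is any commutative ring with `σ : K →+* ℂ` (intended: `K = ℚ̄` or a number
  field); for `K` with transcendental image no instance can exist, which is harmless for an
  interface.
* No fact is named and nothing is claimed: the file contains definitions and proved unfolding /
  bookkeeping lemmas only. What the construction statement will need and is not here: Stokes'
  formula for admissible (semialgebraic, stratified-smooth) chains, semialgebraicity and absolute
  integrability of the pulled-back integrand (Tarski–Seidenberg, area formula), semialgebraic
  triangulations.
* Mathlib has differential forms on normed spaces (`extDeriv`) but no semialgebraic chains, no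
  integration along singular chains and no periods (searched `Period`, `semialgebraic`,
  `singular cube`); the tree's `KZ.*`, `AffineDeRham.*`, `IsSemialgebraicMapOn` are imported, not
  redefined.
-/

noncomputable section

open MeasureTheory Set MvPolynomial
open scoped TensorProduct
open Literature.AlgebraicGeometry.Motives Literature.AlgebraicGeometry.Motives.AffineDeRham
open Literature.ModelTheory.ExponentialFields (IsSemialgebraic)

namespace Literature.NumberTheory.Transcendental

namespace NaivePeriods

variable {N N' i i' : ℕ}

/-! ### Cubes, chains, boundary -/

/-- Real coordinates on `ℂᴺ`: `z ↦ (Re z₁, …, Re z_N, Im z₁, …, Im z_N) ∈ ℝ^{N+N}` (real and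
imaginary parts of the affine coordinates, through which semialgebraicity of subsets of and maps
into `ℂᴺ` is expressed). [Huber–Müller-Stach 2017, §2.6] [folklore] -/
def realCoords (N : ℕ) (z : Fin N → ℂ) : Fin (N + N) → ℝ :=
  Fin.append (fun j => (z j).re) (fun j => (z j).im)

/-- `realCoords` on the first block is the real part. [folklore] -/
@[simp] theorem realCoords_castAdd (z : Fin N → ℂ) (j : Fin N) :
    realCoords N z (Fin.castAdd N j) = (z j).re := by
  rw [realCoords, Fin.append_left]

/-- `realCoords` on the second block is the imaginary part. [folklore] -/
@[simp] theorem realCoords_natAdd (z : Fin N → ℂ) (j : Fin N) :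
    realCoords N z (Fin.natAdd N j) = (z j).im := by
  rw [realCoords, Fin.append_right]

/-- The closed unit cube `[0,1]ⁱ ⊆ ℝⁱ`. [folklore] -/
def closedUnitCube (i : ℕ) : Set (Fin i → ℝ) := Set.pi univ fun _ => Icc 0 1

/-- The open unit cube `(0,1)ⁱ ⊆ ℝⁱ` (the domain of integration; standard orientation
`dt₁ ∧ ⋯ ∧ dtᵢ`). [folklore] -/
def openUnitCube (i : ℕ) : Set (Fin i → ℝ) := Set.pi univ fun _ => Ioo 0 1

/-- Membership in the closed cube. [folklore] -/
@[simp] theorem mem_closedUnitCube (t : Fin i → ℝ) :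
    t ∈ closedUnitCube i ↔ ∀ a, t a ∈ Icc (0 : ℝ) 1 :=
  Set.mem_univ_pi

/-- Membership in the open cube. [folklore] -/
@[simp] theorem mem_openUnitCube (t : Fin i → ℝ) :
    t ∈ openUnitCube i ↔ ∀ a, t a ∈ Ioo (0 : ℝ) 1 :=
  Set.mem_univ_pi

/-- The open cube lies in the closed cube. [folklore] -/
theorem openUnitCube_subset_closedUnitCube : openUnitCube i ⊆ closedUnitCube i :=
  fun t ht => (mem_closedUnitCube t).2 fun a => Ioo_subset_Icc_self ((mem_openUnitCube t).1 ht a)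

/-- The closed cube is `ℚ`-semialgebraic (`0 ≤ tₐ ≤ 1`). [Bochnak–Coste–Roy 1998, §2.1]
[folklore] -/
theorem isSemialgebraic_closedUnitCube : IsSemialgebraic ℚ (closedUnitCube i) := by
  have h := Literature.ModelTheory.ExponentialFields.IsSemialgebraic.biInter (k := ℚ) (R := ℝ)
    (Finset.univ : Finset (Fin i))
    (fun a => {t : Fin i → ℝ | aeval t (0 : MvPolynomial (Fin i) ℚ) ≤ aeval t (X a)} ∩
      {t | aeval t (X a : MvPolynomial (Fin i) ℚ) ≤ aeval t (1 : MvPolynomial (Fin i) ℚ)})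
    (fun a _ => (Literature.ModelTheory.ExponentialFields.isSemialgebraic_setOf_eval_le _ _).inter
      (Literature.ModelTheory.ExponentialFields.isSemialgebraic_setOf_eval_le _ _))
  convert h using 1
  ext t
  simp

/-- The open cube is `ℚ`-semialgebraic (`0 < tₐ < 1`). [Bochnak–Coste–Roy 1998, §2.1] [folklore] -/
theorem isSemialgebraic_openUnitCube : IsSemialgebraic ℚ (openUnitCube i) := by
  have h := Literature.ModelTheory.ExponentialFields.IsSemialgebraic.biInter (k := ℚ) (R := ℝ)
    (Finset.univ : Finset (Fin i))
    (fun a => {t : Fin i → ℝ | aeval t (0 : MvPolynomial (Fin i) ℚ) < aeval t (X a)} ∩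
      {t | aeval t (X a : MvPolynomial (Fin i) ℚ) < aeval t (1 : MvPolynomial (Fin i) ℚ)})
    (fun a _ => (Literature.ModelTheory.ExponentialFields.isSemialgebraic_setOf_eval_lt _ _).inter
      (Literature.ModelTheory.ExponentialFields.isSemialgebraic_setOf_eval_lt _ _))
  convert h using 1
  ext t
  simp

/-- A **singular `i`-cube in `ℂᴺ`**: any map `ℝⁱ → ℂᴺ` (only its values on the closed cube
`[0,1]ⁱ` matter; regularity is the separate predicate `SingularCube.IsAdmissible`).
[Spivak 1965, Ch. 4] [folklore] -/
abbrev SingularCube (N i : ℕ) : Type := (Fin i → ℝ) → (Fin N → ℂ)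

namespace SingularCube

/-- The `(j, ε)`-face of an `(i+1)`-cube: freeze the `j`-th coordinate at `ε` (used with
`ε = 0, 1`), `φ_{(j,ε)}(t) = φ(t₁, …, t_{j-1}, ε, t_j, …, tᵢ)`. [Spivak 1965, Ch. 4] [folklore] -/
def face (j : Fin (i + 1)) (ε : ℝ) (φ : SingularCube N (i + 1)) : SingularCube N i :=
  fun t => φ (Fin.insertNth j ε t)

/-- Unfolding `face`. [folklore] -/
@[simp] theorem face_apply (j : Fin (i + 1)) (ε : ℝ) (φ : SingularCube N (i + 1)) (t : Fin i → ℝ) :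
    face j ε φ t = φ (Fin.insertNth j ε t) := rfl

/-- The **product cube** `φ × ψ : [0,1]^{i+i'} → ℂ^{N+N'}`, `u ↦ (φ(u₁, …, uᵢ), ψ(u_{i+1}, …))`,
blocks realised by `Fin.append` / `Fin.castAdd` / `Fin.natAdd` exactly as in
`KZ.IntegralRep.prodDomain`. [Huber–Müller-Stach, Part III draft 2015, Prop. 11.1.2 (products of
naive periods by Fubini)] [folklore] -/
def prod (φ : SingularCube N i) (ψ : SingularCube N' i') : SingularCube (N + N') (i + i') :=
  fun u => Fin.append (φ fun a => u (Fin.castAdd i' a)) (ψ fun b => u (Fin.natAdd i b))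

/-- Unfolding `prod` on a block vector. [folklore] -/
@[simp] theorem prod_append (φ : SingularCube N i) (ψ : SingularCube N' i') (s : Fin i → ℝ)
    (t : Fin i' → ℝ) : prod φ ψ (Fin.append s t) = Fin.append (φ s) (ψ t) := by
  simp [prod]

/-- **Admissible cubes** — the regularity class of the parametrised pieces of a semialgebraic
triangulation: a `0`-cube is admissible iff its value is a `ℚ`-semialgebraic (= real-algebraic)
point; an `(i+1)`-cube `φ` is admissible iff `realCoords ∘ φ` is a `ℚ`-semialgebraic map on the
closed cube, `φ` is continuous on the closed cube and `C^∞` on the open cube, and all faces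
`φ_{(j,0)}`, `φ_{(j,1)}` are admissible `i`-cubes (so `φ` is smooth on every open face: a
stratified-smooth semialgebraic cube). [Huber–Müller-Stach, Part I draft 2015, Def. 2.6.1,
Def. 2.6.2 (semialgebraic sets and continuous maps with semialgebraic graph, after Hironaka),
Rem. 2.6.6 (`ℂⁿ ≅ ℝ²ⁿ` by real and imaginary parts), Prop. 2.6.8–2.6.9 (semialgebraic
triangulations) = Huber–Müller-Stach 2017, §2.6; Bochnak–Coste–Roy 1998, Thm. 9.2.1] [folklore] -/
def IsAdmissible : {i : ℕ} → SingularCube N i → Prop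
  | 0, φ => IsSemialgebraicMapOn ℚ (closedUnitCube 0) (realCoords N ∘ φ)
  | i + 1, φ => IsSemialgebraicMapOn ℚ (closedUnitCube (i + 1)) (realCoords N ∘ φ) ∧
      ContinuousOn φ (closedUnitCube (i + 1)) ∧ ContDiffOn ℝ (⊤ : ℕ∞) φ (openUnitCube (i + 1)) ∧
      ∀ (j : Fin (i + 1)) (ε : ℝ), (ε = 0 ∨ ε = 1) → IsAdmissible (face j ε φ)

/-- Unfolding admissibility in dimension `0`. [folklore] -/
theorem isAdmissible_zero_iff (φ : SingularCube N 0) :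
    IsAdmissible φ ↔ IsSemialgebraicMapOn ℚ (closedUnitCube 0) (realCoords N ∘ φ) := Iff.rfl

/-- Unfolding admissibility in dimension `i + 1`. [folklore] -/
theorem isAdmissible_succ_iff (φ : SingularCube N (i + 1)) :
    IsAdmissible φ ↔ IsSemialgebraicMapOn ℚ (closedUnitCube (i + 1)) (realCoords N ∘ φ) ∧
      ContinuousOn φ (closedUnitCube (i + 1)) ∧ ContDiffOn ℝ (⊤ : ℕ∞) φ (openUnitCube (i + 1)) ∧
      ∀ (j : Fin (i + 1)) (ε : ℝ), (ε = 0 ∨ ε = 1) → IsAdmissible (face j ε φ) := Iff.rfl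

/-- Faces `ε = 0, 1` of admissible cubes are admissible. [folklore] -/
theorem IsAdmissible.face {φ : SingularCube N (i + 1)} (h : IsAdmissible φ) (j : Fin (i + 1))
    {ε : ℝ} (hε : ε = 0 ∨ ε = 1) : IsAdmissible (face j ε φ) :=
  h.2.2.2 j ε hε

/-- An admissible cube is a `ℚ`-semialgebraic map on the closed cube (in real coordinates).
[folklore] -/
theorem IsAdmissible.isSemialgebraicMapOn : ∀ {i : ℕ} {φ : SingularCube N i}, IsAdmissible φ →
    IsSemialgebraicMapOn ℚ (closedUnitCube i) (realCoords N ∘ φ)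
  | 0, _, h => h
  | _ + 1, _, h => h.1

end SingularCube

/-! ### Two insertions commute (the cubical identities) -/

/-- **Inserting two entries in either order.** For `j : Fin (n+2)`, `k : Fin (n+1)`:
inserting `y` at `k` and then `x` at `j` equals inserting `x` at `k.predAbove j` and then `y` at
`j.succAbove k` — the identity `δ_j^x ∘ δ_k^y = δ_{j'}^y ∘ δ_{k'}^x` behind `∂ ∘ ∂ = 0` for cubical
(and simplicial) face maps; the tuple analogue of Mathlib's `Fin.removeNth_removeNth_eq_swap`.
[Spivak 1965, Ch. 4] [folklore] -/
theorem insertNth_insertNth_comm {α : Type*} {n : ℕ} (j : Fin (n + 2)) (k : Fin (n + 1))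
    (x y : α) (t : Fin n → α) :
    Fin.insertNth (α := fun _ => α) j x (Fin.insertNth (α := fun _ => α) k y t) =
      Fin.insertNth (α := fun _ => α) (j.succAbove k) y
        (Fin.insertNth (α := fun _ => α) (k.predAbove j) x t) := by
  refine (Fin.insertNth_eq_iff.2 ⟨?_, ?_⟩).symm
  · rw [Fin.insertNth_apply_succAbove, Fin.insertNth_apply_same]
  · funext m
    simp only [Fin.removeNth]
    revert m
    refine (Fin.forall_iff_succAbove (k.predAbove j)).2 ⟨?_, fun l => ?_⟩
    · rw [Fin.insertNth_apply_same, Fin.succAbove_succAbove_predAbove, Fin.insertNth_apply_same]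
    · rw [Fin.insertNth_apply_succAbove, Fin.succAbove_succAbove_succAbove_predAbove,
        Fin.insertNth_apply_succAbove, Fin.insertNth_apply_succAbove]

/-- The pair swap `(j, k) ↦ (j.succAbove k, k.predAbove j)` on `Fin (n+2) × Fin (n+1)` (an
involution, by `Fin.succAbove_succAbove_predAbove` and `Fin.predAbove_predAbove_succAbove`): it
matches the term `(j, k)` of `∂∂` with the term it cancels. [folklore] -/
def faceSwap (n : ℕ) : Fin (n + 2) × Fin (n + 1) ≃ Fin (n + 2) × Fin (n + 1) where
  toFun x := (x.1.succAbove x.2, x.2.predAbove x.1)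
  invFun x := (x.1.succAbove x.2, x.2.predAbove x.1)
  left_inv x := Prod.ext (Fin.succAbove_succAbove_predAbove x.1 x.2)
    (Fin.predAbove_predAbove_succAbove x.1 x.2)
  right_inv x := Prod.ext (Fin.succAbove_succAbove_predAbove x.1 x.2)
    (Fin.predAbove_predAbove_succAbove x.1 x.2)

/-- Unfolding `faceSwap`. [folklore] -/
@[simp] theorem faceSwap_apply (n : ℕ) (x : Fin (n + 2) × Fin (n + 1)) :
    faceSwap n x = (x.1.succAbove x.2, x.2.predAbove x.1) := rfl

/-- `faceSwap` has no fixed points. [folklore] -/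
theorem faceSwap_ne {n : ℕ} (x : Fin (n + 2) × Fin (n + 1)) : faceSwap n x ≠ x := fun h =>
  Fin.succAbove_ne x.1 x.2 (congrArg Prod.fst h)

/-- `faceSwap` changes the parity of `j + k`: `(-1)^{j'+k'} = -(-1)^{j+k}`. [folklore] -/
theorem neg_one_pow_faceSwap {n : ℕ} (j : Fin (n + 2)) (k : Fin (n + 1)) :
    ((-1 : ℤ) ^ ((j.succAbove k : ℕ) + (k.predAbove j : ℕ))) = -((-1 : ℤ) ^ ((j : ℕ) + (k : ℕ))) := by
  rcases lt_or_ge (Fin.castSucc k) j with h | h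
  · have hj : (j : ℕ) = (j : ℕ) - 1 + 1 := by
      have : (k : ℕ) < (j : ℕ) := h
      omega
    rw [Fin.succAbove_of_castSucc_lt _ _ h, Fin.predAbove_of_castSucc_lt _ _ h, Fin.val_castSucc,
      Fin.val_pred]
    conv_rhs => rw [hj]
    rw [show (j : ℕ) - 1 + 1 + (k : ℕ) = ((k : ℕ) + ((j : ℕ) - 1)) + 1 by omega, pow_succ]
    simp
  · rw [Fin.succAbove_of_le_castSucc _ _ h, Fin.predAbove_of_le_castSucc _ _ h, Fin.val_succ,
      Fin.coe_castPred]
    rw [show (k : ℕ) + 1 + (j : ℕ) = ((j : ℕ) + (k : ℕ)) + 1 by omega, pow_succ]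
    simp

/-- A sign-twisted double sum of a family invariant under `faceSwap` vanishes: its terms cancel
in pairs `(j, k) ↔ (j.succAbove k, k.predAbove j)` of opposite sign. [folklore] -/
theorem sum_sum_neg_one_pow_smul_eq_zero {M : Type*} [AddCommGroup M] {n : ℕ}
    (C : Fin (n + 2) → Fin (n + 1) → M)
    (hC : ∀ j k, C (j.succAbove k) (k.predAbove j) = C j k) :
    ∑ j : Fin (n + 2), ∑ k : Fin (n + 1), ((-1 : ℤ) ^ ((j : ℕ) + (k : ℕ))) • C j k = 0 := by
  rw [← Finset.sum_product']
  refine Finset.sum_ninvolution (faceSwap n) (fun x => ?_) (fun x _ => faceSwap_ne x)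
    (fun x => Finset.mem_product.2 ⟨Finset.mem_univ _, Finset.mem_univ _⟩)
    (fun x => (faceSwap n).left_inv x)
  rw [faceSwap_apply, hC, neg_one_pow_faceSwap, neg_smul, add_neg_cancel]

/-- Reindexing a sign-twisted double sum by `faceSwap` changes its sign. [folklore] -/
theorem sum_sum_neg_one_pow_smul_faceSwap {M : Type*} [AddCommGroup M] {n : ℕ}
    (C : Fin (n + 2) → Fin (n + 1) → M) :
    ∑ j : Fin (n + 2), ∑ k : Fin (n + 1), ((-1 : ℤ) ^ ((j : ℕ) + (k : ℕ))) • C (j.succAbove k) (k.predAbove j) =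
      -∑ j : Fin (n + 2), ∑ k : Fin (n + 1), ((-1 : ℤ) ^ ((j : ℕ) + (k : ℕ))) • C j k := by
  rw [← Finset.sum_product', ← Finset.sum_product', Finset.univ_product_univ,
    ← Finset.sum_neg_distrib,
    ← Equiv.sum_comp (faceSwap n) (fun x => -(((-1 : ℤ) ^ ((x.1 : ℕ) + (x.2 : ℕ))) • C x.1 x.2))]
  refine Finset.sum_congr rfl fun x _ => ?_
  simp only [faceSwap_apply, neg_one_pow_faceSwap, neg_smul, neg_neg]

/-- The cancellation behind `∂ ∘ ∂ = 0`: for a family `B ε η j k` with the swap symmetry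
`B ε η (j.succAbove k) (k.predAbove j) = B η ε j k` (two face insertions in either order),
`Σ_{j,k} (−1)^{j+k} ((B₁₁ − B₁₀) − (B₀₁ − B₀₀)) = 0`. [Spivak 1965, Ch. 4] [folklore] -/
theorem sum_sum_neg_one_pow_smul_faces_eq_zero {M : Type*} [AddCommGroup M] {n : ℕ}
    (B : ℝ → ℝ → Fin (n + 2) → Fin (n + 1) → M)
    (hB : ∀ ε η j k, B ε η (j.succAbove k) (k.predAbove j) = B η ε j k) :
    ∑ j : Fin (n + 2), ∑ k : Fin (n + 1), ((-1 : ℤ) ^ ((j : ℕ) + (k : ℕ))) •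
      ((B 1 1 j k - B 1 0 j k) - (B 0 1 j k - B 0 0 j k)) = 0 := by
  have hZ : ∀ ε, ∑ j : Fin (n + 2), ∑ k : Fin (n + 1), ((-1 : ℤ) ^ ((j : ℕ) + (k : ℕ))) • B ε ε j k = 0 := fun ε =>
    sum_sum_neg_one_pow_smul_eq_zero (B ε ε) fun j k => hB ε ε j k
  have hL : ∑ j : Fin (n + 2), ∑ k : Fin (n + 1), ((-1 : ℤ) ^ ((j : ℕ) + (k : ℕ))) • B 1 0 j k =
      -∑ j : Fin (n + 2), ∑ k : Fin (n + 1), ((-1 : ℤ) ^ ((j : ℕ) + (k : ℕ))) • B 0 1 j k := by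
    have h := sum_sum_neg_one_pow_smul_faceSwap (B 0 1)
    simp only [hB] at h
    exact h
  simp only [smul_sub, Finset.sum_sub_distrib, hZ, hL]
  abel

/-- **Cubical chains**: the free abelian group on singular `i`-cubes in `ℂᴺ` (formal `ℤ`-linear
combinations; admissibility and support conditions are the predicate
`CubicalChain.IsAdmissibleIn`). [Spivak 1965, Ch. 4] [folklore] -/
abbrev CubicalChain (N i : ℕ) : Type := FreeAbelianGroup (SingularCube N i)

namespace CubicalChain

/-- The chain `[φ]` of a single cube. [folklore] -/
def of (φ : SingularCube N i) : CubicalChain N i := FreeAbelianGroup.of φ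

/-- The **boundary** of cubical chains, `∂[φ] = Σⱼ (−1)ʲ ([φ_{(j,1)}] − [φ_{(j,0)}])` (Spivak's
`Σ_{i,α} (−1)^{i+α} c_{(i,α)}` with `0`-based `j = i − 1`), for which Stokes' formula
`∫_c dω = ∫_{∂c} ω` holds with the standard orientation of the cube. [Spivak 1965, Ch. 4]
[folklore] -/
def boundary : CubicalChain N (i + 1) →+ CubicalChain N i :=
  FreeAbelianGroup.lift fun φ => ∑ j : Fin (i + 1),
    ((-1 : ℤ) ^ (j : ℕ)) • (of (SingularCube.face j 1 φ) - of (SingularCube.face j 0 φ))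

/-- The boundary of a single cube. [Spivak 1965, Ch. 4] [folklore] -/
@[simp] theorem boundary_of (φ : SingularCube N (i + 1)) :
    boundary (of φ) = ∑ j : Fin (i + 1),
      ((-1 : ℤ) ^ (j : ℕ)) • (of (SingularCube.face j 1 φ) - of (SingularCube.face j 0 φ)) :=
  FreeAbelianGroup.lift_apply_of _ _

/-- A chain is **admissible in `S ⊆ ℂᴺ`** if it is a `ℤ`-combination of admissible cubes mapping
the closed cube into `S` ("a semialgebraic chain on `S`"). [Huber–Müller-Stach 2017, §2.6]
[folklore] -/
def IsAdmissibleIn (S : Set (Fin N → ℂ)) (γ : CubicalChain N i) : Prop :=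
  γ ∈ AddSubgroup.closure
    (of '' {φ : SingularCube N i | φ.IsAdmissible ∧ MapsTo φ (closedUnitCube i) S})

/-- A single admissible cube with values in `S` is an admissible chain in `S`. [folklore] -/
theorem isAdmissibleIn_of {S : Set (Fin N → ℂ)} {φ : SingularCube N i} (h : φ.IsAdmissible)
    (hS : MapsTo φ (closedUnitCube i) S) : IsAdmissibleIn S (of φ) :=
  AddSubgroup.subset_closure ⟨φ, ⟨h, hS⟩, rfl⟩

/-- `0` is an admissible chain. [folklore] -/
theorem IsAdmissibleIn.zero (S : Set (Fin N → ℂ)) : IsAdmissibleIn S (0 : CubicalChain N i) :=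
  AddSubgroup.zero_mem _

/-- Sums of admissible chains are admissible. [folklore] -/
theorem IsAdmissibleIn.add {S : Set (Fin N → ℂ)} {γ γ' : CubicalChain N i}
    (h : IsAdmissibleIn S γ) (h' : IsAdmissibleIn S γ') : IsAdmissibleIn S (γ + γ') :=
  AddSubgroup.add_mem _ h h'

/-- Negatives of admissible chains are admissible. [folklore] -/
theorem IsAdmissibleIn.neg {S : Set (Fin N → ℂ)} {γ : CubicalChain N i}
    (h : IsAdmissibleIn S γ) : IsAdmissibleIn S (-γ) :=
  AddSubgroup.neg_mem _ h

/-- Admissibility is monotone in the support condition. [folklore] -/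
theorem IsAdmissibleIn.mono {S T : Set (Fin N → ℂ)} (hST : S ⊆ T) {γ : CubicalChain N i}
    (h : IsAdmissibleIn S γ) : IsAdmissibleIn T γ := by
  refine AddSubgroup.closure_mono ?_ h
  rintro _ ⟨φ, ⟨hφ, hS⟩, rfl⟩
  exact ⟨φ, ⟨hφ, hS.mono_right hST⟩, rfl⟩

/-- **`∂ ∘ ∂ = 0` on a cube**: the faces of the faces cancel in pairs
(`insertNth_insertNth_comm`, opposite signs `neg_one_pow_faceSwap`). [Spivak 1965, Ch. 4]
[folklore] -/
theorem boundary_boundary_of (φ : SingularCube N (i + 2)) : boundary (boundary (of φ)) = 0 := by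
  have h1 : boundary (boundary (of φ)) = ∑ j : Fin (i + 2), ∑ k : Fin (i + 1),
      ((-1 : ℤ) ^ ((j : ℕ) + (k : ℕ))) •
        ((of (SingularCube.face k 1 (SingularCube.face j 1 φ)) -
            of (SingularCube.face k 0 (SingularCube.face j 1 φ))) -
          (of (SingularCube.face k 1 (SingularCube.face j 0 φ)) -
            of (SingularCube.face k 0 (SingularCube.face j 0 φ)))) := by
    rw [boundary_of, map_sum]
    refine Finset.sum_congr rfl fun j _ => ?_
    rw [map_zsmul, map_sub, boundary_of, boundary_of, ← Finset.sum_sub_distrib, Finset.smul_sum]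
    refine Finset.sum_congr rfl fun k _ => ?_
    rw [← smul_sub, smul_smul, ← pow_add]
  rw [h1]
  refine sum_sum_neg_one_pow_smul_faces_eq_zero
    (fun ε η j k => of (SingularCube.face k η (SingularCube.face j ε φ))) fun ε η j k => ?_
  congr 1
  funext t
  simp only [SingularCube.face_apply]
  conv_rhs => rw [insertNth_insertNth_comm]

/-- **`∂ ∘ ∂ = 0`** on cubical chains. [Spivak 1965, Ch. 4] [folklore] -/
theorem boundary_boundary (γ : CubicalChain N (i + 2)) : boundary (boundary γ) = 0 := by
  induction γ using FreeAbelianGroup.induction_on with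
  | zero => simp
  | of φ => exact boundary_boundary_of φ
  | neg φ h => rw [map_neg, map_neg, h, neg_zero]
  | add x y hx hy => rw [map_add, map_add, hx, hy, add_zero]

/-- Faces of the closed cube: `insertNth j ε` maps `[0,1]ⁱ` into `[0,1]^{i+1}` for `ε ∈ [0,1]`.
[folklore] -/
theorem insertNth_mem_closedUnitCube {j : Fin (i + 1)} {ε : ℝ} (hε : ε ∈ Icc (0 : ℝ) 1)
    {t : Fin i → ℝ} (ht : t ∈ closedUnitCube i) : Fin.insertNth j ε t ∈ closedUnitCube (i + 1) := by
  rw [mem_closedUnitCube] at ht ⊢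
  refine (Fin.forall_iff_succAbove j).2 ⟨?_, fun a => ?_⟩
  · rwa [Fin.insertNth_apply_same]
  · rw [Fin.insertNth_apply_succAbove]
    exact ht a

/-- **The boundary of an admissible chain in `S` is an admissible chain in `S`** (faces of
admissible cubes are admissible and stay in `S`). [Huber–Müller-Stach 2017, §2.6] [folklore] -/
theorem IsAdmissibleIn.boundary {S : Set (Fin N → ℂ)} {γ : CubicalChain N (i + 1)}
    (h : IsAdmissibleIn S γ) : IsAdmissibleIn S (boundary γ) := by
  induction h using AddSubgroup.closure_induction with
  | mem x hx =>
    obtain ⟨φ, ⟨hφ, hS⟩, rfl⟩ := hx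
    rw [boundary_of]
    refine AddSubgroup.sum_mem _ fun j _ => AddSubgroup.zsmul_mem _ (AddSubgroup.sub_mem _ ?_ ?_) _
    · exact isAdmissibleIn_of (hφ.face j (Or.inr rfl)) fun t ht =>
        hS (insertNth_mem_closedUnitCube ⟨zero_le_one, le_rfl⟩ ht)
    · exact isAdmissibleIn_of (hφ.face j (Or.inl rfl)) fun t ht =>
        hS (insertNth_mem_closedUnitCube ⟨le_rfl, zero_le_one⟩ ht)
  | zero => rw [map_zero]; exact IsAdmissibleIn.zero S
  | add x y _ _ hx hy => rw [map_add]; exact hx.add hy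
  | neg x _ hx => rw [map_neg]; exact hx.neg

end CubicalChain

/-! ### Complex points of `V(I)` and the complex form attached to a polynomial form -/

variable {K : Type*} [CommRing K] (σ : K →+* ℂ)

/-- The complex points along `σ : K →+* ℂ` of the closed subscheme `U = V(I) ⊆ 𝔸ᴺ_K`:
`U(ℂ) = {z ∈ ℂᴺ | f^σ(z) = 0 for all f ∈ I}`. [Huber–Müller-Stach 2017, §2.6] [folklore] -/
def complexZeroLocus (I : Ideal (MvPolynomial (Fin N) K)) : Set (Fin N → ℂ) :=
  {z | ∀ f ∈ I, eval₂ σ z f = 0}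

/-- Membership in `complexZeroLocus`. [folklore] -/
@[simp] theorem mem_complexZeroLocus (I : Ideal (MvPolynomial (Fin N) K)) (z : Fin N → ℂ) :
    z ∈ complexZeroLocus σ I ↔ ∀ f ∈ I, eval₂ σ z f = 0 := Iff.rfl

/-- The whole affine space: `V(0)(ℂ) = ℂᴺ`. [folklore] -/
@[simp] theorem complexZeroLocus_bot :
    complexZeroLocus σ (⊥ : Ideal (MvPolynomial (Fin N) K)) = univ := by
  ext z
  simp

/-- The complex `i`-form `ω^σ` on `ℂᴺ` attached to a polynomial `i`-form `ω` over `K`, evaluated at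
`z ∈ ℂᴺ` on complex vectors `v₁, …, vᵢ`: the multilinear extension
`ω^σ(z)(v) = Σ_J (∏ₐ (vₐ)_{J a}) · (ω(e_{J 1}, …, e_{J i}))^σ(z)` of the coefficient system of `ω`
(an alternating map on the lattice of constant integer vector fields). [folklore] -/
def evalC (ω : PolyForm K N i) (z : Fin N → ℂ) (v : Fin i → Fin N → ℂ) : ℂ :=
  ∑ J : Fin i → Fin N, (∏ a, v a (J a)) * eval₂ σ z (ω fun a => Pi.single (J a) 1)

/-- `evalC` is additive in the form. [folklore] -/
theorem evalC_add (ω₁ ω₂ : PolyForm K N i) (z : Fin N → ℂ) (v : Fin i → Fin N → ℂ) :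
    evalC σ (ω₁ + ω₂) z v = evalC σ ω₁ z v + evalC σ ω₂ z v := by
  simp [evalC, mul_add, Finset.sum_add_distrib]

/-- `evalC` is `σ`-semilinear in the form: `(c • ω)^σ = σ(c) · ω^σ`. [folklore] -/
theorem evalC_smul (c : K) (ω : PolyForm K N i) (z : Fin N → ℂ) (v : Fin i → Fin N → ℂ) :
    evalC σ (c • ω) z v = σ c * evalC σ ω z v := by
  simp only [evalC, Finset.mul_sum]
  refine Finset.sum_congr rfl fun J _ => ?_
  rw [AlternatingMap.smul_apply, smul_eq_C_mul, eval₂_mul, eval₂_C]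
  ring

/-- In degree `0`, `evalC` is evaluation of the polynomial: `(f)^σ(z) = f^σ(z)`. [folklore] -/
@[simp] theorem evalC_ofPoly (f : MvPolynomial (Fin N) K) (z : Fin N → ℂ) (v : Fin 0 → Fin N → ℂ) :
    evalC σ (ofPoly f) z v = eval₂ σ z f := by
  simp [evalC]

namespace SingularCube

/-- The top coefficient of the pulled-back form:
`(φ^*ω^σ)(e₁, …, eᵢ)(t) = ω^σ(φ t)(∂₁φ(t), …, ∂ᵢφ(t))`, partial derivatives taken with Mathlib's
`fderiv` (the cube is differentiable on the open cube, where this is used). [Spivak 1965, Ch. 4]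
[folklore] -/
def integrand (ω : PolyForm K N i) (φ : SingularCube N i) (t : Fin i → ℝ) : ℂ :=
  evalC σ ω (φ t) fun a => fderiv ℝ φ t (Pi.single a 1)

/-- **`∫_φ ω`**, the integral of the algebraic form `ω` (through `σ`) along the cube `φ`:
`∫_{(0,1)ⁱ} ω^σ(φ(t))(∂₁φ(t), …, ∂ᵢφ(t)) dt` (Bochner integral, Lebesgue measure, standard
orientation). For an admissible cube in `V(I)(ℂ)` and `ω` regular this is a naive period in the
sense of Huber–Müller-Stach. [Huber–Müller-Stach 2017, Def. 12.1.1; Spivak 1965, Ch. 4]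
[cite: HuberMullerStachPeriods2017, Def. 12.1.1] -/
def integral (ω : PolyForm K N i) (φ : SingularCube N i) : ℂ :=
  ∫ t in openUnitCube i, integrand σ ω φ t

/-- **Dimension `0`: the integral is a point evaluation.** For a `0`-cube (a point `z = φ(pt)`)
the integral over the one-point cube `(0,1)⁰` of volume `1` is the value of the integrand, so that
for a `0`-form `f` one gets `∫_φ f = f^σ(z)` (`evalC_ofPoly`). [folklore] -/
theorem integral_eq_integrand_of_dim_zero (ω : PolyForm K N 0) (φ : SingularCube N 0) :
    integral σ ω φ = integrand σ ω φ default := by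
  have h1 : openUnitCube 0 = univ := by
    ext t
    simp
  have h2 : integrand σ ω φ = fun _ => integrand σ ω φ default :=
    funext fun t => congrArg (integrand σ ω φ) (Subsingleton.elim t default)
  have h3 : (volume : Measure (Fin 0 → ℝ)) univ = 1 := by
    rw [MeasureTheory.volume_pi, Measure.pi_univ]
    simp
  rw [integral, h1, MeasureTheory.setIntegral_univ, h2, MeasureTheory.integral_const, measureReal_def,
    h3]
  simp

/-- `∫_φ` is additive in the form as soon as the two integrands are integrable. [folklore] -/
theorem integral_add {ω₁ ω₂ : PolyForm K N i} {φ : SingularCube N i}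
    (h₁ : IntegrableOn (integrand σ ω₁ φ) (openUnitCube i))
    (h₂ : IntegrableOn (integrand σ ω₂ φ) (openUnitCube i)) :
    integral σ (ω₁ + ω₂) φ = integral σ ω₁ φ + integral σ ω₂ φ := by
  have : integrand σ (ω₁ + ω₂) φ = fun t => integrand σ ω₁ φ t + integrand σ ω₂ φ t := by
    funext t; simp [integrand, evalC_add]
  simp only [integral, this]
  exact MeasureTheory.integral_add h₁ h₂

end SingularCube

/-- **`∫_γ ω`** for a cubical chain `γ = Σ n_φ [φ]`: the additive extension `Σ n_φ ∫_φ ω`.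
[Spivak 1965, Ch. 4] [folklore] -/
def CubicalChain.integral (ω : PolyForm K N i) : CubicalChain N i →+ ℂ :=
  FreeAbelianGroup.lift fun φ => SingularCube.integral σ ω φ

/-- `∫_{[φ]} ω = ∫_φ ω`. [folklore] -/
@[simp] theorem CubicalChain.integral_of (ω : PolyForm K N i) (φ : SingularCube N i) :
    CubicalChain.integral σ ω (CubicalChain.of φ) = SingularCube.integral σ ω φ :=
  FreeAbelianGroup.lift_apply_of _ _

/-! ### Exterior product of polynomial forms -/

/-- Pull-back of a polynomial form along a coordinate projection `𝔸ᴹ → 𝔸ᴺ`, `x ↦ x ∘ ρ` for an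
injection of variables `ρ : Fin N → Fin M`: rename the variables of the coefficients and restrict
the arguments. [folklore] -/
def pullbackAlong {M : ℕ} (ρ : Fin N → Fin M) (ω : PolyForm K N i) : PolyForm K M i :=
  ((rename ρ : MvPolynomial (Fin N) K →ₐ[K] MvPolynomial (Fin M) K).toRingHom.toAddMonoidHom
      |>.toIntLinearMap).compAlternatingMap (ω.compLinearMap (LinearMap.funLeft ℤ ℤ ρ))

/-- Unfolding `pullbackAlong`. [folklore] -/
@[simp] theorem pullbackAlong_apply {M : ℕ} (ρ : Fin N → Fin M) (ω : PolyForm K N i)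
    (v : Fin i → Fin M → ℤ) :
    pullbackAlong ρ ω v = rename ρ (ω fun a => v a ∘ ρ) := rfl

/-- The **exterior product** `ω ⊠ ω' = pr₁^*ω ∧ pr₂^*ω'` of polynomial forms on `𝔸ᴺ` and `𝔸ᴺ'`,
a polynomial `(i+i')`-form on `𝔸^{N+N'}` (shuffle product `AlternatingMap.domCoprod` followed by
multiplication of coefficients and the reindexing `Fin i ⊕ Fin i' ≃ Fin (i + i')`). On block
vectors, `(ω ⊠ ω')((v,0), (0,w)) = ω(v) ω'(w)`. [Huber–Müller-Stach, Part III draft 2015,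
Prop. 11.1.2 (`∫_{G₁×G₂} p₁^*ω₁ ∧ p₂^*ω₂ = ∫ω₁ · ∫ω₂`)] [folklore] -/
def boxProd (ω : PolyForm K N i) (ω' : PolyForm K N' i') : PolyForm K (N + N') (i + i') :=
  ((LinearMap.mul' ℤ (MvPolynomial (Fin (N + N')) K)).compAlternatingMap
    ((pullbackAlong (Fin.castAdd N') ω).domCoprod (pullbackAlong (Fin.natAdd N) ω'))).domDomCongr
    finSumFinEquiv

end NaivePeriods

/-! ### Pairs of formal representations: complex multiplication, relations -/

namespace KZ

/-- **Complex multiplication of pairs** of formal representations (real part, imaginary part),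
through the (non-unital) ring structure of `FormalRep` of `KZProduct.lean`:
`(a, b) · (c, d) = (ac − bd, ad + bc)`. [Kontsevich–Zagier 2001, §4.1 p. 31] [folklore] -/
def cmul (x y : FormalRep × FormalRep) : FormalRep × FormalRep :=
  (x.1 * y.1 - x.2 * y.2, x.1 * y.2 + x.2 * y.1)

/-- Unfolding `cmul`, first component. [folklore] -/
@[simp] theorem cmul_fst (x y : FormalRep × FormalRep) : (cmul x y).1 = x.1 * y.1 - x.2 * y.2 := rfl

/-- Unfolding `cmul`, second component. [folklore] -/
@[simp] theorem cmul_snd (x y : FormalRep × FormalRep) : (cmul x y).2 = x.1 * y.2 + x.2 * y.1 := rfl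

/-- The relations on pairs: `relations × relations ≤ FormalRep × FormalRep` (both components are
moves of the Kontsevich–Zagier calculus). [Kontsevich–Zagier 2001, §1.2] [folklore] -/
abbrev relations₂ : AddSubgroup (FormalRep × FormalRep) := relations.prod relations

/-- Membership in `relations₂` is componentwise. [folklore] -/
theorem mem_relations₂ {x : FormalRep × FormalRep} :
    x ∈ relations₂ ↔ x.1 ∈ relations ∧ x.2 ∈ relations := AddSubgroup.mem_prod

end KZ

open NaivePeriods

/-! ### The interface -/

/-- **The pure naive period map — interface** (posited object of route
KontsevichZagierPeriods/MotivatedMoves; the existence of an instance for `K = ℚ̄` is a SEPARATE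
statement and is not claimed here). Over a coefficient ring `K` with an embedding `σ : K →+* ℂ`,
a `PureNaivePeriodMap K σ` assigns to every polynomial `i`-form `ω` on `𝔸ᴺ_K` (representing an
algebraic `i`-form on any closed `U = V(I) ⊆ 𝔸ᴺ`, e.g. an affine open of a smooth projective
`X ⊂ ℙᴹ` in chart coordinates) and every singular `i`-cube `φ` in `ℂᴺ` a pair
`Φ ω φ = (Φ_re, Φ_im)` of formal `ℤ`-combinations of Kontsevich–Zagier integral representations,
such that, for ADMISSIBLE (semialgebraic, stratified-smooth) cubes and modulo
`KZ.relations₂ = relations × relations`: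
* `add_form`, `smul_form` — `Φ` is additive in `ω`, and an algebraic scalar `c` acts through the
  `0`-dimensional constant representations `[pt, Re σc]`, `[pt, Im σc]` (complex multiplication);
* `eval_fst`, `eval_snd` — VALUE-CORRECTNESS: `KZ.eval Φ_re = Re ∫_φ ω`, `KZ.eval Φ_im = Im ∫_φ ω`;
* `vanish` — a form vanishing on `U` (`vanishingForms I i = I·Ωⁱ + dI ∧ Ω^{i-1}`) is sent to
  relations along cubes in `U(ℂ)` (so `Φ` is well defined on `Ωⁱ(U)` modulo relations);
* `exact` — `Φ(dη, γ) ≡ 0` for every closed admissible chain `γ` (exact forms);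
* `boundary` — `Φ(ω, ∂β) ≡ 0` for `ω` closed on `U` and `β` an admissible chain in `U(ℂ)`
  (boundaries; with `exact` this makes `Φ` a pairing `Hⁱ_dR(U) × Hᵢ ↝ FormalRep² ⧸ relations₂`);
* `reparam` — independence of the parametrisation: composing a cube with an orientation-preserving
  `ℚ`-semialgebraic diffeomorphism of the open cube does not change `Φ` (one change-of-variables
  move, KZ rule 2);
* `mul` — MULTIPLICATIVITY: `Φ(ω ⊠ ω', φ × ψ) ≡ Φ(ω, φ) · Φ(ω', ψ)` for the exterior product of
  forms, the product cube and the complex product `KZ.cmul` of pairs (Fubini, KZ §4.1; the product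
  of `KZProduct.lean`).
Additivity in the chain is definitional (`PureNaivePeriodMap.onChain`). Provenance: an INTERFACE
posited by route KontsevichZagierPeriods/MotivatedMoves (item defn-PureNaivePeriodMap), not a
structure found in print; its ingredients are the naive periods and the comparison argument of
[Huber–Müller-Stach 2017, Def. 12.1.1, Thm. 12.2.1 (proof), §2.6 (Part I draft 2015,
Prop. 2.6.8)] and the moves and
products of [Kontsevich–Zagier 2001, §1.2 and §4.1]. [folklore] -/
structure PureNaivePeriodMap (K : Type*) [CommRing K] (σ : K →+* ℂ) where
  /-- The period map on generators: a form and a cube give a pair (real part, imaginary part) of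
  formal combinations of integral representations. Total; meaningful on admissible cubes. -/
  Φ : ∀ {N i : ℕ}, PolyForm K N i → SingularCube N i → KZ.FormalRep × KZ.FormalRep
  /-- Additivity in the form, modulo relations. -/
  add_form : ∀ {N i : ℕ} (ω₁ ω₂ : PolyForm K N i) (φ : SingularCube N i), φ.IsAdmissible →
    Φ (ω₁ + ω₂) φ - (Φ ω₁ φ + Φ ω₂ φ) ∈ KZ.relations₂
  /-- Scalars of `K` act through constant `0`-dimensional representations `[pt, Re σc]`,
  `[pt, Im σc]` (whenever these exist, i.e. `Re σc`, `Im σc` are `ℚ`-semialgebraic constants),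
  by complex multiplication, modulo relations. -/
  smul_form : ∀ {N i : ℕ} (c : K) (ω : PolyForm K N i) (φ : SingularCube N i), φ.IsAdmissible →
    ∀ (r₁ r₂ : KZ.IntegralRep 0), r₁.domain = univ → r₁.integrand = (fun _ => (σ c).re) →
      r₂.domain = univ → r₂.integrand = (fun _ => (σ c).im) →
      Φ (c • ω) φ - KZ.cmul (KZ.of r₁, KZ.of r₂) (Φ ω φ) ∈ KZ.relations₂
  /-- Value-correctness, real part: `eval Φ_re = Re ∫_φ ω`. -/
  eval_fst : ∀ {N i : ℕ} (ω : PolyForm K N i) (φ : SingularCube N i), φ.IsAdmissible →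
    KZ.eval (Φ ω φ).1 = (SingularCube.integral σ ω φ).re
  /-- Value-correctness, imaginary part: `eval Φ_im = Im ∫_φ ω`. -/
  eval_snd : ∀ {N i : ℕ} (ω : PolyForm K N i) (φ : SingularCube N i), φ.IsAdmissible →
    KZ.eval (Φ ω φ).2 = (SingularCube.integral σ ω φ).im
  /-- Forms vanishing on `U = V(I)` go to relations along admissible cubes in `U(ℂ)`. -/
  vanish : ∀ {N i : ℕ} (I : Ideal (MvPolynomial (Fin N) K)) (θ : PolyForm K N i),
    θ ∈ vanishingForms I i → ∀ (φ : SingularCube N i), φ.IsAdmissible →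
      MapsTo φ (closedUnitCube i) (complexZeroLocus σ I) → Φ θ φ ∈ KZ.relations₂
  /-- Exact forms go to relations along closed admissible chains. -/
  exact : ∀ {N i : ℕ} (η : PolyForm K N i) (γ : CubicalChain N (i + 1)),
    γ.IsAdmissibleIn univ → CubicalChain.boundary γ = 0 →
      FreeAbelianGroup.lift (Φ (extDeriv η)) γ ∈ KZ.relations₂
  /-- Forms closed on `U = V(I)` go to relations along boundaries of admissible chains in `U(ℂ)`. -/
  boundary : ∀ {N i : ℕ} (I : Ideal (MvPolynomial (Fin N) K)) (ω : PolyForm K N i),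
    IsClosedOn I ω → ∀ (β : CubicalChain N (i + 1)), β.IsAdmissibleIn (complexZeroLocus σ I) →
      FreeAbelianGroup.lift (Φ ω) (CubicalChain.boundary β) ∈ KZ.relations₂
  /-- Independence of the parametrisation: if `φ₂ = φ₁ ∘ h` on the open cube for a
  `ℚ`-semialgebraic injective `h` of the open cube onto itself with positive Jacobian, then
  `Φ ω φ₂ ≡ Φ ω φ₁`. -/
  reparam : ∀ {N i : ℕ} (ω : PolyForm K N i) (φ₁ φ₂ : SingularCube N i),
    φ₁.IsAdmissible → φ₂.IsAdmissible →
    ∀ (h : (Fin i → ℝ) → (Fin i → ℝ)) (h' : (Fin i → ℝ) → (Fin i → ℝ) →L[ℝ] (Fin i → ℝ)),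
      IsSemialgebraicMapOn ℚ (openUnitCube i) h → (∀ t ∈ openUnitCube i, HasFDerivAt h (h' t) t) →
      (∀ t ∈ openUnitCube i, 0 < (h' t).det) → InjOn h (openUnitCube i) →
      h '' openUnitCube i = openUnitCube i → EqOn φ₂ (φ₁ ∘ h) (openUnitCube i) →
      Φ ω φ₂ - Φ ω φ₁ ∈ KZ.relations₂
  /-- Multiplicativity: exterior product of forms, product of cubes, complex product of pairs. -/
  mul : ∀ {N N' i i' : ℕ} (ω : PolyForm K N i) (ω' : PolyForm K N' i') (φ : SingularCube N i)
    (ψ : SingularCube N' i'), φ.IsAdmissible → ψ.IsAdmissible →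
      Φ (boxProd ω ω') (φ.prod ψ) - KZ.cmul (Φ ω φ) (Φ ω' ψ) ∈ KZ.relations₂

namespace PureNaivePeriodMap

variable {K : Type*} [CommRing K] {σ : K →+* ℂ} (P : PureNaivePeriodMap K σ) {N i : ℕ}

/-- **`Φ` on chains**: the additive extension `Σ n_φ Φ(ω, φ)` of the period map to cubical chains
(additivity in `γ` is built in). [Huber–Müller-Stach 2017, Def. 12.1.1] [folklore] -/
def onChain (ω : PolyForm K N i) : CubicalChain N i →+ KZ.FormalRep × KZ.FormalRep :=
  FreeAbelianGroup.lift (P.Φ ω)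

/-- `Φ` on the chain of a single cube. [folklore] -/
@[simp] theorem onChain_of (ω : PolyForm K N i) (φ : SingularCube N i) :
    P.onChain ω (CubicalChain.of φ) = P.Φ ω φ :=
  FreeAbelianGroup.lift_apply_of _ _

/-- The axiom `exact`, restated with `onChain`: `Φ(dη, γ) ∈ relations₂` for closed admissible `γ`.
[folklore] -/
theorem onChain_extDeriv_mem (η : PolyForm K N i) {γ : CubicalChain N (i + 1)}
    (hγ : γ.IsAdmissibleIn univ) (hc : CubicalChain.boundary γ = 0) :
    P.onChain (extDeriv η) γ ∈ KZ.relations₂ :=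
  P.exact η γ hγ hc

/-- The axiom `boundary`, restated with `onChain`: `Φ(ω, ∂β) ∈ relations₂` for `ω` closed on
`V(I)` and `β` admissible in `V(I)(ℂ)`. [folklore] -/
theorem onChain_boundary_mem (I : Ideal (MvPolynomial (Fin N) K)) {ω : PolyForm K N i}
    (hω : IsClosedOn I ω) {β : CubicalChain N (i + 1)}
    (hβ : β.IsAdmissibleIn (complexZeroLocus σ I)) :
    P.onChain ω (CubicalChain.boundary β) ∈ KZ.relations₂ :=
  P.boundary I ω hω β hβ

/-- **Independence of the triangulation (closed forms)**: two admissible cycles in `U(ℂ)` that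
differ by the boundary of an admissible chain in `U(ℂ)` — e.g. the fundamental chains of two
semialgebraic triangulations of the same oriented compact semialgebraic cycle — have equivalent
images under `Φ` for every form closed on `U`. [Huber–Müller-Stach 2017, Def. 12.1.1 and
Prop. 2.6.8] [folklore] -/
theorem onChain_sub_onChain_mem_of_boundary (I : Ideal (MvPolynomial (Fin N) K))
    {ω : PolyForm K N i} (hω : IsClosedOn I ω) {γ₁ γ₂ : CubicalChain N i}
    {β : CubicalChain N (i + 1)} (hβ : β.IsAdmissibleIn (complexZeroLocus σ I))
    (h : γ₁ - γ₂ = CubicalChain.boundary β) :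
    P.onChain ω γ₁ - P.onChain ω γ₂ ∈ KZ.relations₂ := by
  rw [← map_sub, h]
  exact P.onChain_boundary_mem I hω hβ

/-- The zero form is sent to relations along admissible cubes (from additivity:
`Φ(0 + 0) ≡ Φ 0 + Φ 0`). [folklore] -/
theorem Φ_zero_mem (φ : SingularCube N i) (hφ : φ.IsAdmissible) :
    P.Φ (0 : PolyForm K N i) φ ∈ KZ.relations₂ := by
  have h := P.add_form 0 0 φ hφ
  rw [add_zero] at h
  have : P.Φ (0 : PolyForm K N i) φ - (P.Φ 0 φ + P.Φ 0 φ) = -P.Φ 0 φ := by abel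
  rw [this] at h
  simpa using KZ.relations₂.neg_mem h

/-- Additivity in the form along admissible chains: `Φ(ω₁ + ω₂, γ) ≡ Φ(ω₁, γ) + Φ(ω₂, γ)`
(induction on the chain from `add_form`). [folklore] -/
theorem onChain_add_sub_mem {S : Set (Fin N → ℂ)} (ω₁ ω₂ : PolyForm K N i) {γ : CubicalChain N i}
    (hγ : γ.IsAdmissibleIn S) :
    P.onChain (ω₁ + ω₂) γ - (P.onChain ω₁ γ + P.onChain ω₂ γ) ∈ KZ.relations₂ := by
  induction hγ using AddSubgroup.closure_induction with
  | mem x hx =>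
    obtain ⟨φ, ⟨hφ, -⟩, rfl⟩ := hx
    simpa only [onChain_of] using P.add_form ω₁ ω₂ φ hφ
  | zero =>
    simp only [map_zero, add_zero, sub_self]
    exact AddSubgroup.zero_mem _
  | add x y _ _ hx hy =>
    have : P.onChain (ω₁ + ω₂) (x + y) - (P.onChain ω₁ (x + y) + P.onChain ω₂ (x + y)) =
        (P.onChain (ω₁ + ω₂) x - (P.onChain ω₁ x + P.onChain ω₂ x)) +
          (P.onChain (ω₁ + ω₂) y - (P.onChain ω₁ y + P.onChain ω₂ y)) := by
      simp only [map_add]; abel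
    rw [this]
    exact AddSubgroup.add_mem _ hx hy
  | neg x _ hx =>
    have : P.onChain (ω₁ + ω₂) (-x) - (P.onChain ω₁ (-x) + P.onChain ω₂ (-x)) =
        -(P.onChain (ω₁ + ω₂) x - (P.onChain ω₁ x + P.onChain ω₂ x)) := by
      simp only [map_neg]; abel
    rw [this]
    exact AddSubgroup.neg_mem _ hx

/-- The axiom `vanish` along chains: a form vanishing on `V(I)` is sent to `relations₂` along
every admissible chain in `V(I)(ℂ)`. [folklore] -/
theorem onChain_mem_of_mem_vanishingForms (I : Ideal (MvPolynomial (Fin N) K))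
    {θ : PolyForm K N i} (hθ : θ ∈ vanishingForms I i) {γ : CubicalChain N i}
    (hγ : γ.IsAdmissibleIn (complexZeroLocus σ I)) : P.onChain θ γ ∈ KZ.relations₂ := by
  induction hγ using AddSubgroup.closure_induction with
  | mem x hx =>
    obtain ⟨φ, ⟨hφ, hS⟩, rfl⟩ := hx
    rw [onChain_of]
    exact P.vanish I θ hθ φ hφ hS
  | zero =>
    rw [map_zero]
    exact AddSubgroup.zero_mem _
  | add x y _ _ hx hy =>
    rw [map_add]
    exact AddSubgroup.add_mem _ hx hy
  | neg x _ hx =>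
    rw [map_neg]
    exact AddSubgroup.neg_mem _ hx

/-- **`Φ` descends to regular forms on `U`**: two polynomial forms with the same restriction to
`U = V(I)` (difference in `vanishingForms I i`, i.e. the same element of
`AffineDeRham.RegularForm I i = Ωⁱ(U)`) have equivalent images along every admissible chain in
`U(ℂ)`. [folklore] -/
theorem onChain_sub_onChain_mem_of_sub_mem_vanishingForms (I : Ideal (MvPolynomial (Fin N) K))
    {ω₁ ω₂ : PolyForm K N i} (h : ω₁ - ω₂ ∈ vanishingForms I i) {γ : CubicalChain N i}
    (hγ : γ.IsAdmissibleIn (complexZeroLocus σ I)) :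
    P.onChain ω₁ γ - P.onChain ω₂ γ ∈ KZ.relations₂ := by
  have h1 := P.onChain_add_sub_mem (ω₁ - ω₂) ω₂ hγ
  rw [sub_add_cancel] at h1
  have h2 := P.onChain_mem_of_mem_vanishingForms I h hγ
  have : P.onChain ω₁ γ - P.onChain ω₂ γ =
      (P.onChain ω₁ γ - (P.onChain (ω₁ - ω₂) γ + P.onChain ω₂ γ)) + P.onChain (ω₁ - ω₂) γ := by
    abel
  rw [this]
  exact AddSubgroup.add_mem _ h1 h2

/-- **Value-correctness on chains**: for an admissible chain `γ` (in any `S`),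
`eval (Φ.onChain ω γ)_re = Re ∫_γ ω` and `eval (Φ.onChain ω γ)_im = Im ∫_γ ω` (induction on the
chain from `eval_fst`, `eval_snd`). [Huber–Müller-Stach 2017, Def. 12.1.1] [folklore] -/
theorem eval_onChain {S : Set (Fin N → ℂ)} (ω : PolyForm K N i) {γ : CubicalChain N i}
    (hγ : γ.IsAdmissibleIn S) :
    KZ.eval (P.onChain ω γ).1 = (CubicalChain.integral σ ω γ).re ∧
      KZ.eval (P.onChain ω γ).2 = (CubicalChain.integral σ ω γ).im := by
  induction hγ using AddSubgroup.closure_induction with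
  | mem x hx =>
    obtain ⟨φ, ⟨hφ, -⟩, rfl⟩ := hx
    simp only [onChain_of, CubicalChain.integral_of]
    exact ⟨P.eval_fst ω φ hφ, P.eval_snd ω φ hφ⟩
  | zero => simp
  | add x y _ _ hx hy =>
    simp only [map_add, Prod.fst_add, Prod.snd_add, Complex.add_re, Complex.add_im]
    exact ⟨by rw [hx.1, hy.1], by rw [hx.2, hy.2]⟩
  | neg x _ hx =>
    simp only [map_neg, Prod.fst_neg, Prod.snd_neg, Complex.neg_re, Complex.neg_im]
    exact ⟨by rw [hx.1], by rw [hx.2]⟩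

/-- Consequence of `boundary` and value-correctness inside the calculus: for `ω` closed on `V(I)`
and `β` admissible in `V(I)(ℂ)`, the pair `Φ(ω, ∂β)` lies in `relations₂`, hence — given the
soundness of the moves `KZ.relations_le_ker_eval` — both its evaluations vanish. [folklore] -/
theorem eval_onChain_boundary_eq_zero (hsound : KZ.relations_le_ker_eval)
    (I : Ideal (MvPolynomial (Fin N) K)) {ω : PolyForm K N i} (hω : IsClosedOn I ω)
    {β : CubicalChain N (i + 1)} (hβ : β.IsAdmissibleIn (complexZeroLocus σ I)) :
    KZ.eval (P.onChain ω (CubicalChain.boundary β)).1 = 0 ∧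
      KZ.eval (P.onChain ω (CubicalChain.boundary β)).2 = 0 := by
  have h := KZ.mem_relations₂.mp (P.onChain_boundary_mem I hω hβ)
  exact ⟨hsound h.1, hsound h.2⟩

end PureNaivePeriodMap

end Literature.NumberTheory.Transcendental
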